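import Mathlib.Analysis.SpecialFunctions.SmoothTransition
import Literature.Analysis.FluidPDE.GloballyDissipativeEulerIteration
import Literature.Analysis.FluidPDE.GloballyDissipativeEulerStart
import Literature.Analysis.FunctionSpaces.TorusTrigPolyDerivBounds
import HarnessLib

/-!
# De Lellis–Kwon 2022, Thm. 1.1 from the inductive proposition (Prop. 2.3) alone:
# the energy loss, the inductive estimates (2.4)–(2.9), the starting tuple at `q = 0`,
# and the induction (§2.1, §2.3)

Proofs file on the discharge path of the named fact `Torus.DeLellisKwon2022_thm11`
(`GloballyDissipativeEuler`; C. De Lellis, H. Kwon, Anal. PDE 15 (2022) = arXiv:2006.06482,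
Thm. 1.1). `GloballyDissipativeEulerIteration` reduces Thm. 1.1 to the existence, for every
`β < 1/7` and `T > 0`, of an *iteration sequence* (`DLK.IsIterationSequence`). The printed proof
(§2.3) produces that sequence by (i) choosing `α ∈ (β, 1/7)`, the parameters `b`, `λ₀` of
Prop. 2.3 and a nontrivial energy loss `E` with (2.9) and `‖E''‖₀ ≤ δ₀δ₁`; (ii) checking that the
starting tuple `(v₀, 0, R₀, 0, 0)` of §2.3 satisfies the inductive estimates (2.4)–(2.8) at
`q = 0` once `λ̄` and `λ₀` are suitably chosen; (iii) applying Prop. 2.3 inductively. This file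
formalises (i)–(iii), so that the only remaining input is Prop. 2.3 itself, transcribed as the
hypothesis `hprop` of `DLK.deLellisKwon2022_thm11_of_inductiveProposition`:

* `DLK.energyLoss ε = -ε S` (`S` = `Real.smoothTransition`) and `DLK.exists_energyLoss` — a smooth
  `E` on `ℝ` with `E(0) = 0`, `E' ≤ 0`, `E(T) < E(0)` (`T > 0`), `‖E‖₀ ≤ δ₁`,
  `‖E'‖₀ ≤ δ₀^{1/2}δ₁`, `‖E''‖₀ ≤ δ₀δ₁` (§2.3: "choose for example
  `E(t) = -δ₁(1 - exp(-δ₀^{1/2}t))`" — which is unbounded for `t → -∞`; the bounded profile here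
  serves (2.9), whose norms are sups over `ℝ`);
* `DLK.DerivSupOn S F k B` — `sup_{S × 𝕋³} ‖∂^θ F‖ ≤ B` for all spatial multi-indices `|θ| = k`
  (`Torus.iterPartialDeriv`), the currency of the `C⁰_t C^N_x` norms `‖F‖_N` of §2.1;
* `DLK.InductiveHypothesis M α a b S q v p R φ` — the inductive estimates (2.4), (2.6)–(2.8) on
  the time set `S` (= `[0,T] + τ_{q-1}`), order by order (`N ≤ 2`; advective derivatives
  `D_t = ∂ₜ + v_q·∇` via `Torus.timeDerivWithin S` + `Torus.convect`), and
  `DLK.EnergyLossHypothesis α a b E` — (2.9);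
* `DLK.InductiveHypothesis.start` — **the starting tuple satisfies (2.4)–(2.8) at `q = 0`** on
  `S = ℝ`, with `λ̄ = 2π` (`n = 1`) and under explicit largeness conditions on `λ₀` (§2.3:
  "we just need a sufficiently large `λ₀`");
* `DLK.exists_iterationSequence_of_step` — the induction (dependent choice,
  `BDSV.exists_seq_of_step`) turning a step map with the conclusions of Prop. 2.3 into a
  `DLK.IsIterationSequence`;
* `DLK.deLellisKwon2022_thm11_of_inductiveProposition` — **Thm. 1.1 from Prop. 2.3**: the named
  fact follows from the inductive proposition, transcribed with its printed quantifier structure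
  ("There exists a geometric constant `M > 1` and functions `b̄(α) > 1` and `Λ₀(α, b, M) > 0` such
  that ... Let `α ∈ (0, 1/7)`, `b ∈ (1, b̄(α))` and `λ₀ ≥ Λ₀` ... Then we can find a corrected
  dissipative Euler–Reynolds flow ... which satisfies (2.4)–(2.8) for `q+1` and (2.10)"), the
  time domains `[0,T] + τ_q` being left to the step (any sets `S_q ⊇ [0,T]` with `S₀ = ℝ`) and
  the pressure kept (`p_{q+1} = p_q`, §4.2). Prop. 2.3 — the convex-integration construction of
  §§3–11 — is NOT proved in the tree; this theorem isolates it as the exact remaining input.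

## References

* C. De Lellis, H. Kwon, *On nonuniqueness of Hölder continuous globally dissipative Euler
  flows*, Anal. PDE 15 (2022) 2003–2059 = arXiv:2006.06482: §2.1 ((2.4)–(2.10)), Prop. 2.3,
  §2.3 (proof of Thm. 1.1: `E`, starting tuple, parameter choice), §4.2 (`p_{q+1} = p_q`).
  [DelellisKwon2022]
-/

noncomputable section

open MeasureTheory Set Filter Function UnitAddTorus
open scoped ENNReal NNReal InnerProductSpace RealInnerProductSpace ContDiff Topology

namespace Literature.Analysis.FluidPDE

namespace DLK

open FunctionSpaces FunctionSpaces.Torus BDSV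

/-- The flat three-torus `𝕋³ = (ℝ/ℤ)³`, local notation. -/
local notation "𝕋³" => UnitAddTorus (Fin 3)

/-- Euclidean `ℝ³`, local notation. -/
local notation "ℝ³" => EuclideanSpace ℝ (Fin 3)

/-! ## Part 1. A normalised energy-loss profile (§2.3, (2.9)) -/

section EnergyLoss

/-- The normalised energy-loss profile `E_ε(t) = -ε S(t)`, `S` Mathlib's `Real.smoothTransition`
(smooth, nondecreasing, `S = 0` on `(-∞,0]`, `S = 1` on `[1,∞)`): a bounded smooth substitute,
defined on all of `ℝ`, for the printed `-δ₁(1 - exp(-δ₀^{1/2} t))` (unbounded for `t → -∞`,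
while (2.9) asks for sup bounds on `ℝ`). [cite: DelellisKwon2022, §2.3 (choice of E)] -/
def energyLoss (ε : ℝ) (t : ℝ) : ℝ := -ε * Real.smoothTransition t

variable {ε t : ℝ}

/-- `E_ε(0) = 0` ((2.9): `E(0) = 0`). [folklore] -/
@[simp] theorem energyLoss_zero (ε : ℝ) : energyLoss ε 0 = 0 := by
  simp [energyLoss, Real.smoothTransition.zero]

/-- `E_ε ≤ 0` for `ε ≥ 0`. [folklore] -/
theorem energyLoss_nonpos (hε : 0 ≤ ε) (t : ℝ) : energyLoss ε t ≤ 0 := by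
  unfold energyLoss
  nlinarith [Real.smoothTransition.nonneg t]

/-- `-ε ≤ E_ε`. [folklore] -/
theorem neg_le_energyLoss (hε : 0 ≤ ε) (t : ℝ) : -ε ≤ energyLoss ε t := by
  unfold energyLoss
  nlinarith [Real.smoothTransition.le_one t]

/-- `|E_ε| ≤ ε` ((2.9), `n = 0`, with `ε ≤ δ₁`). [folklore] -/
theorem abs_energyLoss_le (hε : 0 ≤ ε) (t : ℝ) : |energyLoss ε t| ≤ ε :=
  abs_le.2 ⟨neg_le_energyLoss hε t, (energyLoss_nonpos hε t).trans hε⟩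

/-- `E_ε(T) < E_ε(0)` for `T > 0`, `ε > 0`: the energy loss is nontrivial on `[0,T]`
("`E` is not identically `0`. In particular `E(T) - E(0) < 0`"). [cite: DelellisKwon2022, §2.3] -/
theorem energyLoss_lt_energyLoss_zero (hε : 0 < ε) {T : ℝ} (hT : 0 < T) :
    energyLoss ε T < energyLoss ε 0 := by
  rw [energyLoss_zero]
  unfold energyLoss
  nlinarith [Real.smoothTransition.pos_of_pos hT]

/-- `E_ε` is smooth. [folklore] -/
theorem contDiff_energyLoss (ε : ℝ) : ContDiff ℝ ∞ (energyLoss ε) :=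
  contDiff_const.mul Real.smoothTransition.contDiff

/-- `E_ε' = -ε S'`. [folklore] -/
theorem deriv_energyLoss (ε t : ℝ) :
    deriv (energyLoss ε) t = -ε * deriv Real.smoothTransition t := by
  unfold energyLoss
  exact deriv_const_mul _ (((Real.smoothTransition.contDiff (n := 1)).differentiable (by simp)) t)

/-- `E_ε'' = -ε S''`. [folklore] -/
theorem deriv_deriv_energyLoss (ε t : ℝ) :
    deriv (deriv (energyLoss ε)) t = -ε * deriv (deriv Real.smoothTransition) t := by
  have h : deriv (energyLoss ε) = fun s => -ε * deriv Real.smoothTransition s :=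
    funext (deriv_energyLoss ε)
  rw [h]
  exact deriv_const_mul _
    (((Real.smoothTransition.contDiff (n := 2)).differentiable_deriv_two).differentiableAt)

/-- `E_ε' ≤ 0` for `ε ≥ 0` ((2.9): `E' ≤ 0`; `S` is nondecreasing). [folklore] -/
theorem deriv_energyLoss_nonpos (hε : 0 ≤ ε) (t : ℝ) : deriv (energyLoss ε) t ≤ 0 := by
  rw [deriv_energyLoss]
  have h : 0 ≤ deriv Real.smoothTransition t := Real.smoothTransition.monotone.deriv_nonneg
  nlinarith

/-- A continuous function on `ℝ` vanishing off `[0,1]` is bounded. [folklore] -/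
theorem exists_forall_abs_le_of_eq_zero_off {f : ℝ → ℝ} (hf : Continuous f)
    (h : ∀ t, t ∉ Icc (0 : ℝ) 1 → f t = 0) : ∃ C, 0 ≤ C ∧ ∀ t, |f t| ≤ C := by
  obtain ⟨C, hC⟩ := isCompact_Icc.exists_bound_of_continuousOn (hf.continuousOn (s := Icc (0 : ℝ) 1))
  refine ⟨max C 0, le_max_right _ _, fun t => ?_⟩
  by_cases ht : t ∈ Icc (0 : ℝ) 1
  · exact ((Real.norm_eq_abs _).symm.le.trans (hC t ht)).trans (le_max_left _ _)
  · rw [h t ht, abs_zero]; exact le_max_right _ _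

/-- `S'` vanishes off `[0,1]` (`S` is locally constant there). [folklore] -/
theorem deriv_smoothTransition_eq_zero_off {t : ℝ} (ht : t ∉ Icc (0 : ℝ) 1) :
    deriv Real.smoothTransition t = 0 := by
  rw [mem_Icc, not_and_or, not_le, not_le] at ht
  rcases ht with ht | ht
  · have h : deriv Real.smoothTransition t = deriv (fun _ : ℝ => (0 : ℝ)) t := by
      refine Filter.EventuallyEq.deriv_eq ?_
      filter_upwards [Iio_mem_nhds ht] with s hs
      exact Real.smoothTransition.zero_of_nonpos (le_of_lt hs)
    rw [h, deriv_const]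
  · have h : deriv Real.smoothTransition t = deriv (fun _ : ℝ => (1 : ℝ)) t := by
      refine Filter.EventuallyEq.deriv_eq ?_
      filter_upwards [Ioi_mem_nhds ht] with s hs
      exact Real.smoothTransition.one_of_one_le (le_of_lt hs)
    rw [h, deriv_const]

/-- `S''` vanishes off `[0,1]`. [folklore] -/
theorem deriv_deriv_smoothTransition_eq_zero_off {t : ℝ} (ht : t ∉ Icc (0 : ℝ) 1) :
    deriv (deriv Real.smoothTransition) t = 0 := by
  rw [mem_Icc, not_and_or, not_le, not_le] at ht
  rcases ht with ht | ht
  · have h : deriv (deriv Real.smoothTransition) t = deriv (fun _ : ℝ => (0 : ℝ)) t := by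
      refine Filter.EventuallyEq.deriv_eq ?_
      filter_upwards [Iio_mem_nhds ht] with s hs
      exact deriv_smoothTransition_eq_zero_off fun hs' => (not_le.2 hs) hs'.1
    rw [h, deriv_const]
  · have h : deriv (deriv Real.smoothTransition) t = deriv (fun _ : ℝ => (0 : ℝ)) t := by
      refine Filter.EventuallyEq.deriv_eq ?_
      filter_upwards [Ioi_mem_nhds ht] with s hs
      exact deriv_smoothTransition_eq_zero_off fun hs' => (not_le.2 hs) hs'.2
    rw [h, deriv_const]

/-- **Uniform bounds on `S'` and `S''`**: there is `C_S ≥ 1` with `|S'|, |S''| ≤ C_S` on `ℝ`. [folklore] -/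
theorem exists_bound_derivs_smoothTransition :
    ∃ C : ℝ, 1 ≤ C ∧ (∀ t, |deriv Real.smoothTransition t| ≤ C) ∧
      ∀ t, |deriv (deriv Real.smoothTransition) t| ≤ C := by
  have hc1 : Continuous (deriv Real.smoothTransition) :=
    (Real.smoothTransition.contDiff (n := 1)).continuous_deriv le_rfl
  have hc2 : Continuous (deriv (deriv Real.smoothTransition)) := by
    have h2 : ContDiff ℝ 2 Real.smoothTransition := Real.smoothTransition.contDiff (n := 2)
    have := h2.iterate_deriv' 0 2
    simpa using this.continuous
  obtain ⟨C₁, -, h₁⟩ := exists_forall_abs_le_of_eq_zero_off hc1 fun t ht =>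
    deriv_smoothTransition_eq_zero_off ht
  obtain ⟨C₂, -, h₂⟩ := exists_forall_abs_le_of_eq_zero_off hc2 fun t ht =>
    deriv_deriv_smoothTransition_eq_zero_off ht
  exact ⟨max 1 (max C₁ C₂), le_max_left _ _,
    fun t => (h₁ t).trans ((le_max_left _ _).trans (le_max_right _ _)),
    fun t => (h₂ t).trans ((le_max_right _ _).trans (le_max_right _ _))⟩

/-- **An energy loss with (2.9) and `‖E''‖₀ ≤ δ₀δ₁`** (§2.3: "the existence of a nontrivial
smooth function `E` with `E(0) = 0`, `E' ≤ 0`, and `‖E^{(n)}‖₀ ≤ δ₀^{n/2}δ₁` for `n = 0,1,2`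
is obvious"): given `0 < δ₀ ≤ 1` and `0 < δ₁`, there is a smooth `E : ℝ → ℝ` with `E(0) = 0`,
`E' ≤ 0`, `E(T) < E(0)` for every `T > 0`, `-δ₁ ≤ E ≤ 0`, `‖E'‖₀ ≤ δ₀^{1/2}δ₁`,
`‖E''‖₀ ≤ δ₀δ₁` (sups over `ℝ`; take `E = E_ε`, `ε = δ₀δ₁/C_S`). [cite: DelellisKwon2022, §2.3 (choice of E)] -/
theorem exists_energyLoss {δ₀ δ₁ : ℝ} (hδ₀ : 0 < δ₀) (hδ₀1 : δ₀ ≤ 1) (hδ₁ : 0 < δ₁) :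
    ∃ E : ℝ → ℝ, ContDiff ℝ ∞ E ∧ E 0 = 0 ∧ (∀ t, deriv E t ≤ 0) ∧
      (∀ T, 0 < T → E T < E 0) ∧ (∀ t, -δ₁ ≤ E t ∧ E t ≤ 0) ∧
      (∀ t, |deriv E t| ≤ Real.sqrt δ₀ * δ₁) ∧ (∀ t, |deriv (deriv E) t| ≤ δ₀ * δ₁) := by
  obtain ⟨C, hC1, hS1, hS2⟩ := exists_bound_derivs_smoothTransition
  have hC0 : 0 < C := by linarith
  set ε : ℝ := δ₀ * δ₁ / C with hε
  have hε0 : 0 < ε := by positivity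
  have hεδ : ε ≤ δ₁ := by
    rw [hε, div_le_iff₀ hC0]
    nlinarith
  have hεC : ε * C = δ₀ * δ₁ := by rw [hε]; field_simp
  have hsqrt : δ₀ ≤ Real.sqrt δ₀ := by
    rw [Real.le_sqrt hδ₀.le hδ₀.le]
    nlinarith
  refine ⟨energyLoss ε, contDiff_energyLoss ε, energyLoss_zero ε, deriv_energyLoss_nonpos hε0.le,
    fun T hT => energyLoss_lt_energyLoss_zero hε0 hT,
    fun t => ⟨(neg_le_neg hεδ).trans (neg_le_energyLoss hε0.le t), energyLoss_nonpos hε0.le t⟩,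
    fun t => ?_, fun t => ?_⟩
  · rw [deriv_energyLoss, abs_mul, abs_neg, abs_of_pos hε0]
    calc ε * |deriv Real.smoothTransition t| ≤ ε * C := by gcongr; exact hS1 t
      _ = δ₀ * δ₁ := hεC
      _ ≤ Real.sqrt δ₀ * δ₁ := by gcongr
  · rw [deriv_deriv_energyLoss, abs_mul, abs_neg, abs_of_pos hε0]
    calc ε * |deriv (deriv Real.smoothTransition) t| ≤ ε * C := by gcongr; exact hS2 t
      _ = δ₀ * δ₁ := hεC

end EnergyLoss

/-! ## Part 2. The inductive estimates (2.4)–(2.9) -/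

section Hypotheses

variable {Y : Type*} [NormedAddCommGroup Y] [NormedSpace ℝ Y]

/-- `sup_{S × 𝕋³} ‖∂^θ F‖ ≤ B` for every spatial multi-index `θ` of order exactly `k`
(`Torus.iterPartialDeriv` along lists of coordinate directions of length `k`): the order-`k`
part of the `C⁰_t C^N_x` norms `‖F‖_N = ‖F‖_{C⁰(S; C^N(𝕋³))}` of DLK §2.1.
[cite: DelellisKwon2022, §2.1 (definition of ‖F_q‖_N)] -/
def DerivSupOn (S : Set ℝ) (F : ℝ → 𝕋³ → Y) (k : ℕ) (B : ℝ) : Prop :=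
  ∀ l : List (Fin 3), l.length = k → ∀ t ∈ S, ∀ x, ‖iterPartialDeriv l (F t) x‖ ≤ B

variable {S S' : Set ℝ} {F : ℝ → 𝕋³ → Y} {k : ℕ} {B B' : ℝ}

/-- Order `0`: `DerivSupOn S F 0 B` is the sup bound `‖F t x‖ ≤ B`. [folklore] -/
theorem DerivSupOn.norm_le (h : DerivSupOn S F 0 B) {t : ℝ} (ht : t ∈ S) (x : 𝕋³) : ‖F t x‖ ≤ B :=
  h [] rfl t ht x

/-- Order `1`: `DerivSupOn S F 1 B` bounds every first partial derivative. [folklore] -/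
theorem DerivSupOn.norm_partialDeriv_le (h : DerivSupOn S F 1 B) (i : Fin 3) {t : ℝ} (ht : t ∈ S)
    (x : 𝕋³) : ‖Torus.partialDeriv i (F t) x‖ ≤ B :=
  h [i] rfl t ht x

/-- Restriction to a smaller time set. [folklore] -/
theorem DerivSupOn.anti (h : DerivSupOn S F k B) (hS : S' ⊆ S) : DerivSupOn S' F k B :=
  fun l hl t ht x => h l hl t (hS ht) x

/-- Monotonicity in the bound. [folklore] -/
theorem DerivSupOn.mono (h : DerivSupOn S F k B) (hB : B ≤ B') : DerivSupOn S F k B' :=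
  fun l hl t ht x => (h l hl t ht x).trans hB

/-- The zero field satisfies every nonnegative derivative bound. [folklore] -/
theorem derivSupOn_zero (S : Set ℝ) (k : ℕ) (hB : 0 ≤ B) :
    DerivSupOn S (fun (_ : ℝ) (_ : 𝕋³) => (0 : Y)) k B := by
  intro l hl t _ x
  by_cases h : l = []
  · subst h; simpa using hB
  · have := iterPartialDeriv_const (d := Fin 3) (0 : Y) l h
    rw [this]; simpa using hB

/-- **The inductive estimates of DLK §2.1 at stage `q` on the time set `S`** (`S = [0,T] + τ_{q-1}`
in the source), for the tuple `(v, p, R, φ)` (`κ = ½ tr R`, (2.5), being part of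
`Torus.IsDissipativeEulerReynoldsOn`), relative to `M`, `α`, `λ_q = BDSV.freq a b q`,
`δ_q = BDSV.amp α a b q`, `γ = (b-1)²`, read order by order (`‖F‖_N ≤ X_N` for the listed `N` as
`sup ‖∂^θF‖ ≤ X_{|θ|}`, `D_t = ∂ₜ + v·∇` with the time derivative within `S`):
(2.4) `‖v_q‖₀ ≤ 1 - δ_q^{1/2}`, `‖v_q‖_N ≤ Mλ_q^Nδ_q^{1/2}` and `‖p_q‖_N ≤ λ_q^Nδ_q` (`N = 1,2`;
order `0` of `p` bounded by `λ_qδ_q`); (2.6) `‖D_tp_q‖_{N-1} ≤ δ_q^{3/2}λ_q^N`;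
(2.7) `‖R_q‖_N ≤ λ_q^{N-3γ}δ_{q+1}` (`N = 0,1,2`), `‖D_tR_q‖_{N-1} ≤ λ_q^{N-3γ}δ_q^{1/2}δ_{q+1}`;
(2.8) `‖φ_q‖_N ≤ λ_q^{N-3γ}δ_{q+1}^{3/2}`, `‖D_tφ_q‖_{N-1} ≤ λ_q^{N-3γ}δ_q^{1/2}δ_{q+1}^{3/2}`
(`N = 1,2` for the advective bounds, Rem. 2.2). [cite: DelellisKwon2022, §2.1 (2.4)–(2.8)] -/
structure InductiveHypothesis (M α a b : ℝ) (S : Set ℝ) (q : ℕ) (v : ℝ → 𝕋³ → ℝ³)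
    (p : ℝ → 𝕋³ → ℝ) (R : ℝ → 𝕋³ → Fin 3 → ℝ³) (φ : ℝ → 𝕋³ → ℝ³) : Prop where
  /-- (2.4): `‖v_q‖₀ ≤ 1 - δ_q^{1/2}`. -/
  velocity_zero : DerivSupOn S v 0 (1 - Real.sqrt (amp α a b q))
  /-- (2.4): `‖v_q‖_N ≤ M λ_q^N δ_q^{1/2}`, `N = 1, 2`. -/
  velocity_le : ∀ k, 1 ≤ k → k ≤ 2 → DerivSupOn S v k (M * freq a b q ^ k * Real.sqrt (amp α a b q))
  /-- (2.4): `‖p_q‖_N ≤ λ_q^N δ_q`, `N = 1, 2` (order `0` included with `λ_q δ_q`). -/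
  pressure_le : ∀ k, k ≤ 2 → DerivSupOn S p k (freq a b q ^ (max k 1) * amp α a b q)
  /-- (2.6): `‖D_t p_q‖_{N-1} ≤ δ_q^{3/2} λ_q^N`, `N = 1, 2`. -/
  pressure_adv : ∀ k, k ≤ 1 → DerivSupOn S
    (fun t x => Torus.timeDerivWithin S p t x + Torus.convect (v t) (p t) x) k
    (amp α a b q ^ (3 / 2 : ℝ) * freq a b q ^ (k + 1))
  /-- (2.7): `‖R_q‖_N ≤ λ_q^{N-3γ} δ_{q+1}`, `N = 0, 1, 2`. -/
  stress_le : ∀ k, k ≤ 2 → DerivSupOn S R k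
    (freq a b q ^ ((k : ℝ) - 3 * (b - 1) ^ 2) * amp α a b (q + 1))
  /-- (2.7): `‖D_t R_q‖_{N-1} ≤ λ_q^{N-3γ} δ_q^{1/2} δ_{q+1}`, `N = 1, 2`. -/
  stress_adv : ∀ k, k ≤ 1 → DerivSupOn S
    (fun t x => Torus.timeDerivWithin S R t x + Torus.convect (v t) (R t) x) k
    (freq a b q ^ ((k : ℝ) + 1 - 3 * (b - 1) ^ 2) * Real.sqrt (amp α a b q) * amp α a b (q + 1))
  /-- (2.8): `‖φ_q‖_N ≤ λ_q^{N-3γ} δ_{q+1}^{3/2}`, `N = 0, 1, 2`. -/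
  current_le : ∀ k, k ≤ 2 → DerivSupOn S φ k
    (freq a b q ^ ((k : ℝ) - 3 * (b - 1) ^ 2) * amp α a b (q + 1) ^ (3 / 2 : ℝ))
  /-- (2.8): `‖D_t φ_q‖_{N-1} ≤ λ_q^{N-3γ} δ_q^{1/2} δ_{q+1}^{3/2}`, `N = 1, 2`. -/
  current_adv : ∀ k, k ≤ 1 → DerivSupOn S
    (fun t x => Torus.timeDerivWithin S φ t x + Torus.convect (v t) (φ t) x) k
    (freq a b q ^ ((k : ℝ) + 1 - 3 * (b - 1) ^ 2) * Real.sqrt (amp α a b q) *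
      amp α a b (q + 1) ^ (3 / 2 : ℝ))

/-- **The standing assumptions (2.9) on the energy loss**: `E` smooth on `ℝ`, `E(0) = 0`,
`E' ≤ 0`, `‖E‖₀ ≤ δ₁`, `‖E'‖₀ ≤ δ₀^{1/2}δ₁` (sups over `ℝ`). [cite: DelellisKwon2022, §2.1 (2.9)] -/
structure EnergyLossHypothesis (α a b : ℝ) (E : ℝ → ℝ) : Prop where
  /-- `E` is smooth. -/
  smooth : ContDiff ℝ ∞ E
  /-- `E(0) = 0`. -/
  zero : E 0 = 0
  /-- `E' ≤ 0`. -/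
  deriv_nonpos : ∀ t, deriv E t ≤ 0
  /-- `‖E‖₀ ≤ δ₁`. -/
  abs_le : ∀ t, |E t| ≤ amp α a b 1
  /-- `‖E'‖₀ ≤ δ₀^{1/2} δ₁`. -/
  abs_deriv_le : ∀ t, |deriv E t| ≤ Real.sqrt (amp α a b 0) * amp α a b 1

end Hypotheses

/-! ## Part 3. The starting tuple satisfies the inductive estimates at `q = 0` (§2.3) -/

section Start

variable {n : ℕ} {g : ℝ → ℝ}

/-- Columns commute with iterated partial derivatives of a smooth column-tensor field. [folklore] -/
theorem iterPartialDeriv_apply_col {T : 𝕋³ → Fin 3 → ℝ³} (hT : IsSmooth T) (j : Fin 3) :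
    ∀ (l : List (Fin 3)) (x : 𝕋³),
      iterPartialDeriv l T x j = iterPartialDeriv l (fun y => T y j) x
  | [], _ => rfl
  | i :: l, x => by
    rw [iterPartialDeriv_cons, iterPartialDeriv_cons]
    have h := partialDeriv_clm_comp (hT.iterPartialDeriv l)
      (ContinuousLinearMap.proj (R := ℝ) (φ := fun _ : Fin 3 => ℝ³) j) i x
    have heq : (fun y => iterPartialDeriv l T y j) = iterPartialDeriv l (fun y => T y j) :=
      funext (iterPartialDeriv_apply_col hT j l)
    rw [← heq]
    exact h.symm

/-- All-order bounds for the shear mode: `‖∂^l P_n‖ ≤ √2 (2πn)^{|l|}`. [folklore] -/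
theorem norm_iterPartialDeriv_profile_le (n : ℕ) (l : List (Fin 3)) (x : 𝕋³) :
    ‖iterPartialDeriv l (PulsedShear.profile n) x‖ ≤ Real.sqrt 2 * (2 * Real.pi * n) ^ l.length := by
  have h := norm_iterPartialDeriv_realTrigPoly_singleton_le (PulsedShear.freq n) (fun _ => PulsedShear.pol) l x
  rw [PulsedShear.freqNormSq_freq, Real.sqrt_sq (Nat.cast_nonneg n), CDLDR.norm_pol] at h
  rw [mul_comm]
  exact h

/-- All-order bounds for the stress profile: `‖∂^l S_n‖ ≤ √2 (2πn)^{|l|}` (sup over columns). [folklore] -/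
theorem norm_iterPartialDeriv_stressProfile_le (n : ℕ) (l : List (Fin 3)) (x : 𝕋³) :
    ‖iterPartialDeriv l (CDLDR.stressProfile n) x‖ ≤ Real.sqrt 2 * (2 * Real.pi * n) ^ l.length := by
  refine (pi_norm_le_iff_of_nonneg (by positivity)).2 fun j => ?_
  rw [iterPartialDeriv_apply_col (CDLDR.isSmooth_stressProfile n) j l x, CDLDR.stressProfile_col]
  have h := norm_iterPartialDeriv_realTrigPoly_singleton_le (PulsedShear.freq n) (fun _ => CDLDR.stressPol j) l x
  rw [PulsedShear.freqNormSq_freq, Real.sqrt_sq (Nat.cast_nonneg n)] at h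
  refine h.trans ?_
  rw [mul_comm]
  exact mul_le_mul_of_nonneg_right (CDLDR.norm_stressPol_le j) (by positivity)

/-- All-order bounds for fields `c(t) Ψ` with `‖∂^lΨ‖ ≤ √2 (2πn)^{|l|}`:
`‖∂^l (c Ψ)‖ ≤ |c| √2 (2πn)^{|l|}`. [folklore] -/
theorem norm_iterPartialDeriv_smul_le {Y : Type*} [NormedAddCommGroup Y] [NormedSpace ℝ Y]
    {Ψ : 𝕋³ → Y} (hΨ : IsSmooth Ψ) {A : ℝ}
    (hb : ∀ (l : List (Fin 3)) (x : 𝕋³), ‖iterPartialDeriv l Ψ x‖ ≤ A * (2 * Real.pi * n) ^ l.length)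
    (c : ℝ) (l : List (Fin 3)) (x : 𝕋³) :
    ‖iterPartialDeriv l (fun y => c • Ψ y) x‖ ≤ |c| * (A * (2 * Real.pi * n) ^ l.length) := by
  rw [iterPartialDeriv_const_smul hΨ c l]
  simp only [norm_smul, Real.norm_eq_abs]
  exact mul_le_mul_of_nonneg_left (hb l x) (abs_nonneg c)

variable {E : ℝ → ℝ} {c₀ : ℝ}

/-- The amplitude `g = (c₀ + E)^{1/2}` and its first two derivatives when `c₀ + E ≥ 1/2`,
`|E'| ≤ A₁`, `|E''| ≤ A₂`: `0 < g`, `|g| ≤ (c₀ + sup E)^{1/2}` aside, `|g'| ≤ A₁` and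
`|g''| ≤ A₂ + 2A₁²` (`g' = E'/(2g)`, `g'' = E''/(2g) - E'²/(4g³)`, `2g ≥ √2 ≥ 1`, `4g³ ≥ √2`). [folklore] -/
theorem sqrt_amplitude_derivs (hE : ContDiff ℝ ∞ E) (hpos : ∀ t, 1 / 2 ≤ c₀ + E t) {A₁ A₂ : ℝ}
    (h1 : ∀ t, |deriv E t| ≤ A₁) (h2 : ∀ t, |deriv (deriv E) t| ≤ A₂) :
    (∀ t, deriv (fun s => Real.sqrt (c₀ + E s)) t = deriv E t / (2 * Real.sqrt (c₀ + E t))) ∧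
    (∀ t, |deriv (fun s => Real.sqrt (c₀ + E s)) t| ≤ A₁) ∧
    (∀ t, |deriv (deriv (fun s => Real.sqrt (c₀ + E s))) t| ≤ A₂ + 2 * A₁ ^ 2) := by
  set g : ℝ → ℝ := fun s => Real.sqrt (c₀ + E s) with hg
  have hp : ∀ t, 0 < c₀ + E t := fun t => lt_of_lt_of_le (by norm_num) (hpos t)
  have hgpos : ∀ t, 0 < g t := fun t => Real.sqrt_pos.2 (hp t)
  have hg_ge : ∀ t, Real.sqrt (1 / 2) ≤ g t := fun t => Real.sqrt_le_sqrt (hpos t)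
  have hhalf : (1 : ℝ) / 2 ≤ Real.sqrt (1 / 2) := by
    rw [Real.le_sqrt (by norm_num) (by norm_num)]; norm_num
  have hg_half : ∀ t, 1 / 2 ≤ g t := fun t => hhalf.trans (hg_ge t)
  have hEd : ∀ t, HasDerivAt E (deriv E t) t := fun t => ((hE.differentiable (by simp)) t).hasDerivAt
  have hE'd : ∀ t, HasDerivAt (deriv E) (deriv (deriv E) t) t := fun t =>
    (((hE.of_le (by norm_cast)).differentiable_deriv_two) t).hasDerivAt
  have hgd : ∀ t, HasDerivAt g (deriv E t / (2 * g t)) t := fun t => by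
    have := ((hEd t).const_add c₀).sqrt (hp t).ne'
    simpa [hg] using this
  have hg' : ∀ t, deriv g t = deriv E t / (2 * g t) := fun t => (hgd t).deriv
  have hA₁ : 0 ≤ A₁ := (abs_nonneg _).trans (h1 0)
  -- first derivative bound
  have hb1 : ∀ t, |deriv g t| ≤ A₁ := fun t => by
    rw [hg', abs_div, abs_of_pos (by linarith [hgpos t] : 0 < 2 * g t)]
    rw [div_le_iff₀ (by linarith [hgpos t])]
    calc |deriv E t| ≤ A₁ := h1 t
      _ = A₁ * 1 := (mul_one _).symm
      _ ≤ A₁ * (2 * g t) := by gcongr; linarith [hg_half t]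
  refine ⟨hg', hb1, fun t => ?_⟩
  -- second derivative: quotient rule for `E'/(2g)`
  have hq : HasDerivAt (fun s => deriv E s / (2 * g s))
      ((deriv (deriv E) t * (2 * g t) - deriv E t * (2 * (deriv E t / (2 * g t)))) / (2 * g t) ^ 2) t :=
    (hE'd t).div ((hgd t).const_mul 2) (ne_of_gt (by linarith [hgpos t])) |>.congr_deriv (by ring)
  have hderiv2 : deriv (deriv g) t =
      (deriv (deriv E) t * (2 * g t) - deriv E t * (2 * (deriv E t / (2 * g t)))) / (2 * g t) ^ 2 := by
    have hfun : deriv g = fun s => deriv E s / (2 * g s) := funext hg'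
    rw [hfun]
    exact hq.deriv
  rw [hderiv2]
  have hgt := hgpos t
  have h2g : 0 < 2 * g t := by linarith
  -- simplify: `= E''/(2g) - E'^2/(4 g^3)`
  have hsimp : (deriv (deriv E) t * (2 * g t) - deriv E t * (2 * (deriv E t / (2 * g t)))) / (2 * g t) ^ 2 =
      deriv (deriv E) t / (2 * g t) - deriv E t ^ 2 / (4 * g t ^ 3) := by
    field_simp
    ring
  rw [hsimp]
  have hterm1 : |deriv (deriv E) t / (2 * g t)| ≤ A₂ := by
    rw [abs_div, abs_of_pos h2g, div_le_iff₀ h2g]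
    have hA₂ : 0 ≤ A₂ := (abs_nonneg _).trans (h2 0)
    calc |deriv (deriv E) t| ≤ A₂ := h2 t
      _ = A₂ * 1 := (mul_one _).symm
      _ ≤ A₂ * (2 * g t) := by gcongr; linarith [hg_half t]
  have hterm2 : |deriv E t ^ 2 / (4 * g t ^ 3)| ≤ 2 * A₁ ^ 2 := by
    have h4 : 0 < 4 * g t ^ 3 := by positivity
    rw [abs_div, abs_of_pos h4, div_le_iff₀ h4, abs_pow]
    have hsq : |deriv E t| ^ 2 ≤ A₁ ^ 2 := pow_le_pow_left₀ (abs_nonneg _) (h1 t) 2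
    have hg3 : (1 : ℝ) / 8 ≤ g t ^ 3 := by
      have := hg_half t
      calc (1 : ℝ) / 8 = (1 / 2) ^ 3 := by norm_num
        _ ≤ g t ^ 3 := pow_le_pow_left₀ (by norm_num) this 3
    nlinarith
  calc |deriv (deriv E) t / (2 * g t) - deriv E t ^ 2 / (4 * g t ^ 3)|
      ≤ |deriv (deriv E) t / (2 * g t)| + |deriv E t ^ 2 / (4 * g t ^ 3)| := abs_sub _ _
    _ ≤ A₂ + 2 * A₁ ^ 2 := add_le_add hterm1 hterm2

/-- **De Lellis–Kwon 2022, §2.3: the starting tuple satisfies the inductive estimates (2.4)–(2.8)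
at `q = 0`** on the whole time axis (`[0,T] + τ₋₁ = ℝ`), for `λ̄ = 2π` (`n = 1`):
`v₀ = (1 - 2δ₀^{1/2} + E)^{1/2} P₁`, `p₀ = 0`, `R₀ = ((1 - 2δ₀^{1/2} + E)^{1/2})'/(2π) S₁`,
`φ₀ = 0`. Printed: "`‖v₀‖_N ≤ (1-2δ₀^{1/2})^{1/2} λ̄^N` ... (2.4) is satisfied as soon as
`λ̄ ≤ λ₀δ₀^{1/2}` ... `‖R₀‖_N ≤ C λ̄^{N-1}‖E'‖₀`, `‖D_tR₀‖_N = ‖∂ₜR₀‖_N ≤ Cλ̄^{N-1}(‖E''‖₀ + ‖E'‖₀²)`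
... it suffices to impose `‖E''‖₀ ≤ δ₀δ₁` and `λ̄ ≥ Cλ₀^{3γ}δ₀^{1/2}` ... we just need a
sufficiently large `λ₀`". Here the requirements are kept as the explicit hypotheses `HE`
(`2δ₀^{1/2} + δ₁ ≤ ½`, so that `1 - 2δ₀^{1/2} + E ≥ ½`), `HV1`–`HV2` ((2.4) for `N = 1,2`),
`HR0`–`HR2` ((2.7)), `HD0`–`HD1` ((2.7), advective part), all of the form
"constant `≤` positive power of `λ₀`" once `3γ ≤ α`; they are discharged for `λ₀` large in
`DLK.deLellisKwon2022_thm11_of_inductiveProposition`. On `E`: smooth, `-δ₁ ≤ E ≤ 0`,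
`‖E'‖₀ ≤ δ₀^{1/2}δ₁`, `‖E''‖₀ ≤ δ₀δ₁` (`DLK.exists_energyLoss`).
[cite: DelellisKwon2022, §2.3 (proof of Thm. 1.1, estimates of the starting tuple)] -/
theorem InductiveHypothesis.start {M α a b : ℝ} (ha : 1 ≤ a) (hb : 1 ≤ b) (hα : 0 ≤ α)
    {E : ℝ → ℝ} (hE : ContDiff ℝ ∞ E) (hE0 : ∀ t, -amp α a b 1 ≤ E t ∧ E t ≤ 0)
    (hE1 : ∀ t, |deriv E t| ≤ Real.sqrt (amp α a b 0) * amp α a b 1)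
    (hE2 : ∀ t, |deriv (deriv E) t| ≤ amp α a b 0 * amp α a b 1)
    (HE : 2 * Real.sqrt (amp α a b 0) + amp α a b 1 ≤ 1 / 2)
    (HV1 : Real.sqrt 2 * (2 * Real.pi) ≤ M * freq a b 0 * Real.sqrt (amp α a b 0))
    (HV2 : Real.sqrt 2 * (2 * Real.pi) ^ 2 ≤ M * freq a b 0 ^ 2 * Real.sqrt (amp α a b 0))
    (HR0 : Real.sqrt 2 * Real.sqrt (amp α a b 0) ≤
      2 * Real.pi * freq a b 0 ^ (-(3 * (b - 1) ^ 2)))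
    (HR1 : Real.sqrt 2 * Real.sqrt (amp α a b 0) ≤ freq a b 0 ^ (1 - 3 * (b - 1) ^ 2))
    (HR2 : Real.sqrt 2 * (2 * Real.pi) * Real.sqrt (amp α a b 0) ≤ freq a b 0 ^ (2 - 3 * (b - 1) ^ 2))
    (HD0 : 3 * Real.sqrt 2 * Real.sqrt (amp α a b 0) ≤ 2 * Real.pi * freq a b 0 ^ (1 - 3 * (b - 1) ^ 2))
    (HD1 : 3 * Real.sqrt 2 * Real.sqrt (amp α a b 0) ≤ freq a b 0 ^ (2 - 3 * (b - 1) ^ 2)) :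
    InductiveHypothesis M α a b univ 0
      (CDLDR.shearVelocity 1 fun t => Real.sqrt (1 - 2 * Real.sqrt (amp α a b 0) + E t))
      (fun _ _ => 0)
      (startStress 1 fun t => Real.sqrt (1 - 2 * Real.sqrt (amp α a b 0) + E t))
      (fun _ _ => 0) := by
  -- notation
  set s₀ := Real.sqrt (amp α a b 0) with hs₀
  set δ₀ := amp α a b 0 with hδ₀
  set δ₁ := amp α a b 1 with hδ₁
  set lam := freq a b 0 with hlam
  set c₀ : ℝ := 1 - 2 * s₀ with hc₀
  set g : ℝ → ℝ := fun t => Real.sqrt (c₀ + E t) with hg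
  have hL : (0 : ℝ) < 2 * Real.pi := by positivity
  have hδ₀pos : 0 < δ₀ := amp_pos ha 0
  have hδ₁pos : 0 < δ₁ := amp_pos ha 1
  have hs₀pos : 0 < s₀ := Real.sqrt_pos.2 hδ₀pos
  have hδ₁le : δ₁ ≤ δ₀ := amp_succ_le ha hb hα 0
  have hδ₀le : δ₀ ≤ s₀ := amp_le_sqrt_amp ha hα 0
  have hδ₁one : δ₁ ≤ 1 := amp_le_one ha hα 1
  have hlam1 : 1 ≤ lam := one_le_freq ha 0
  -- positivity of the amplitude: `c₀ + E ≥ 1/2`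
  have hpos : ∀ t, 1 / 2 ≤ c₀ + E t := fun t => by
    have := (hE0 t).1
    rw [hc₀]; linarith
  have hpos' : ∀ t, 0 < c₀ + E t := fun t => lt_of_lt_of_le (by norm_num) (hpos t)
  have hgsm : ContDiff ℝ ∞ g := by
    rw [← contDiffOn_univ]; exact contDiffOn_sqrt_const_add hE fun t _ => hpos' t
  -- `|g| ≤ 1 - s₀` and `|g| ≤ 1`
  have hg_le : ∀ t, |g t| ≤ 1 - s₀ := fun t => by
    rw [abs_of_nonneg (Real.sqrt_nonneg _)]
    have h1 : c₀ + E t ≤ (1 - s₀) ^ 2 := by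
      have := (hE0 t).2
      rw [hc₀]; nlinarith
    calc g t = Real.sqrt (c₀ + E t) := rfl
      _ ≤ Real.sqrt ((1 - s₀) ^ 2) := Real.sqrt_le_sqrt h1
      _ = 1 - s₀ := Real.sqrt_sq (by linarith)
  have hg_one : ∀ t, |g t| ≤ 1 := fun t => (hg_le t).trans (by linarith)
  -- derivatives of `g`
  obtain ⟨-, hg1, hg2⟩ := sqrt_amplitude_derivs (c₀ := c₀) hE hpos hE1 hE2
  have hg2' : ∀ t, |deriv (deriv g) t| ≤ 3 * (δ₀ * δ₁) := fun t => by
    refine (hg2 t).trans ?_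
    have : (s₀ * δ₁) ^ 2 ≤ δ₀ * δ₁ := by
      rw [mul_pow, hs₀, Real.sq_sqrt hδ₀pos.le]
      nlinarith
    linarith
  -- profile bounds for `n = 1`
  have hP : ∀ (l : List (Fin 3)) (x : 𝕋³), ‖iterPartialDeriv l (PulsedShear.profile 1) x‖ ≤
      Real.sqrt 2 * (2 * Real.pi) ^ l.length := fun l x => by
    simpa using norm_iterPartialDeriv_profile_le 1 l x
  have hS : ∀ (l : List (Fin 3)) (x : 𝕋³), ‖iterPartialDeriv l (CDLDR.stressProfile 1) x‖ ≤
      Real.sqrt 2 * (2 * Real.pi) ^ l.length := fun l x => by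
    simpa using norm_iterPartialDeriv_stressProfile_le 1 l x
  -- the advective derivative of the stress is `(g''/(2π)) S₁`
  have hadvR : (fun t x => Torus.timeDerivWithin univ (startStress 1 g) t x +
      Torus.convect (CDLDR.shearVelocity 1 g t) (startStress 1 g t) x) =
      fun t x => (deriv (deriv g) t / (2 * Real.pi * (1 : ℕ))) • CDLDR.stressProfile 1 x := by
    funext t x
    rw [timeDerivWithin_startStress isOpen_univ subset_rfl uniqueDiffOn_univ hgsm.contDiffOn (mem_univ t),
      convect_startStress, add_zero]
    congr 1
    simp only [div_eq_mul_inv]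
    exact deriv_mul_const_field _
  -- the advective derivatives of the zero fields vanish
  have hadv0 : ∀ {Y : Type} [NormedAddCommGroup Y] [NormedSpace ℝ Y],
      (fun t x => Torus.timeDerivWithin univ (fun (_ : ℝ) (_ : 𝕋³) => (0 : Y)) t x +
        Torus.convect (CDLDR.shearVelocity 1 g t) ((fun (_ : ℝ) (_ : 𝕋³) => (0 : Y)) t) x) =
      fun (_ : ℝ) (_ : 𝕋³) => (0 : Y) := by
    intro Y _ _
    funext t x
    rw [Torus.timeDerivWithin_zero, Torus.convect_zero_right, add_zero]
  refine ⟨?_, ?_, ?_, ?_, ?_, ?_, ?_, ?_⟩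
  · -- (2.4), order 0
    intro l hl t _ x
    rw [List.length_eq_zero_iff.1 hl, iterPartialDeriv_nil, CDLDR.norm_shearVelocity]
    exact hg_le t
  · -- (2.4), orders 1, 2
    intro k hk1 hk2 l hl t _ x
    have hb' := norm_iterPartialDeriv_smul_le (n := 1) (PulsedShear.isSmooth_profile 1) (A := Real.sqrt 2)
      (by simpa using hP) (g t) l x
    have hstep : ‖iterPartialDeriv l (CDLDR.shearVelocity 1 g t) x‖ ≤ Real.sqrt 2 * (2 * Real.pi) ^ k := by
      refine (le_of_eq_of_le rfl hb').trans ?_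
      rw [hl]
      calc |g t| * (Real.sqrt 2 * (2 * Real.pi * (1 : ℕ)) ^ k) ≤ 1 * (Real.sqrt 2 * (2 * Real.pi * (1 : ℕ)) ^ k) :=
            mul_le_mul_of_nonneg_right (hg_one t) (by positivity)
        _ = Real.sqrt 2 * (2 * Real.pi) ^ k := by simp
    refine hstep.trans ?_
    interval_cases k
    · simpa using HV1
    · simpa using HV2
  · -- (2.4) for `p₀ = 0`
    intro k _
    exact derivSupOn_zero _ _ (by positivity)
  · -- (2.6) for `p₀ = 0`
    intro k _
    rw [hadv0]
    exact derivSupOn_zero _ _ (by positivity)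
  · -- (2.7), orders 0, 1, 2
    intro k hk l hl t _ x
    have hb' := norm_iterPartialDeriv_smul_le (n := 1) (CDLDR.isSmooth_stressProfile 1) (A := Real.sqrt 2)
      (by simpa using hS) (deriv g t / (2 * Real.pi * (1 : ℕ))) l x
    have hcoef : |deriv g t / (2 * Real.pi * (1 : ℕ))| ≤ s₀ * δ₁ / (2 * Real.pi) := by
      rw [Nat.cast_one, mul_one, abs_div, abs_of_pos hL]
      exact div_le_div_of_nonneg_right (hg1 t) hL.le
    have hstep : ‖iterPartialDeriv l (startStress 1 g t) x‖ ≤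
        s₀ * δ₁ / (2 * Real.pi) * (Real.sqrt 2 * (2 * Real.pi) ^ k) := by
      refine (le_of_eq_of_le rfl hb').trans ?_
      rw [hl]
      simpa using mul_le_mul_of_nonneg_right hcoef (by positivity : (0:ℝ) ≤ Real.sqrt 2 * (2 * Real.pi) ^ k)
    refine hstep.trans ?_
    interval_cases k
    · -- `k = 0`: `HR0`
      simp only [pow_zero, mul_one, Nat.cast_zero, zero_sub]
      rw [div_mul_eq_mul_div, div_le_iff₀ hL]
      calc s₀ * δ₁ * Real.sqrt 2 = (Real.sqrt 2 * s₀) * δ₁ := by ring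
        _ ≤ (2 * Real.pi * lam ^ (-(3 * (b - 1) ^ 2))) * δ₁ := mul_le_mul_of_nonneg_right HR0 hδ₁pos.le
        _ = lam ^ (-(3 * (b - 1) ^ 2)) * δ₁ * (2 * Real.pi) := by ring
    · -- `k = 1`: `HR1`
      simp only [pow_one, Nat.cast_one]
      calc s₀ * δ₁ / (2 * Real.pi) * (Real.sqrt 2 * (2 * Real.pi)) = (Real.sqrt 2 * s₀) * δ₁ := by
            field_simp
        _ ≤ lam ^ ((1 : ℝ) - 3 * (b - 1) ^ 2) * δ₁ := mul_le_mul_of_nonneg_right HR1 hδ₁pos.le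
    · -- `k = 2`: `HR2`
      simp only [Nat.cast_ofNat]
      calc s₀ * δ₁ / (2 * Real.pi) * (Real.sqrt 2 * (2 * Real.pi) ^ 2) =
            (Real.sqrt 2 * (2 * Real.pi) * s₀) * δ₁ := by field_simp
        _ ≤ lam ^ ((2 : ℝ) - 3 * (b - 1) ^ 2) * δ₁ := mul_le_mul_of_nonneg_right HR2 hδ₁pos.le
  · -- (2.7), advective part, orders 0, 1
    intro k hk l hl t _ x
    rw [hadvR]
    have hb' := norm_iterPartialDeriv_smul_le (n := 1) (CDLDR.isSmooth_stressProfile 1) (A := Real.sqrt 2)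
      (by simpa using hS) (deriv (deriv g) t / (2 * Real.pi * (1 : ℕ))) l x
    have hcoef : |deriv (deriv g) t / (2 * Real.pi * (1 : ℕ))| ≤ 3 * (δ₀ * δ₁) / (2 * Real.pi) := by
      rw [Nat.cast_one, mul_one, abs_div, abs_of_pos hL]
      exact div_le_div_of_nonneg_right (hg2' t) hL.le
    have hstep : ‖iterPartialDeriv l (fun y => (deriv (deriv g) t / (2 * Real.pi * (1 : ℕ))) • CDLDR.stressProfile 1 y) x‖ ≤
        3 * (δ₀ * δ₁) / (2 * Real.pi) * (Real.sqrt 2 * (2 * Real.pi) ^ k) := by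
      refine hb'.trans ?_
      rw [hl]
      simpa using mul_le_mul_of_nonneg_right hcoef (by positivity : (0:ℝ) ≤ Real.sqrt 2 * (2 * Real.pi) ^ k)
    refine (le_of_eq_of_le rfl hstep).trans ?_
    have hδ₀s : δ₀ = s₀ * s₀ := by rw [hs₀, Real.mul_self_sqrt hδ₀pos.le]
    interval_cases k
    · -- `k = 0`: `HD0`
      simp only [pow_zero, mul_one, Nat.cast_zero, zero_add]
      rw [div_mul_eq_mul_div, div_le_iff₀ hL, hδ₀s]
      calc 3 * (s₀ * s₀ * δ₁) * Real.sqrt 2 = (3 * Real.sqrt 2 * s₀) * (s₀ * δ₁) := by ring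
        _ ≤ (2 * Real.pi * lam ^ ((1 : ℝ) - 3 * (b - 1) ^ 2)) * (s₀ * δ₁) :=
            mul_le_mul_of_nonneg_right HD0 (by positivity)
        _ = lam ^ ((1 : ℝ) - 3 * (b - 1) ^ 2) * s₀ * δ₁ * (2 * Real.pi) := by ring
    · -- `k = 1`: `HD1`
      simp only [pow_one, Nat.cast_one]
      rw [hδ₀s]
      have h2 : (1 : ℝ) + 1 - 3 * (b - 1) ^ 2 = 2 - 3 * (b - 1) ^ 2 := by ring
      rw [h2]
      calc 3 * (s₀ * s₀ * δ₁) / (2 * Real.pi) * (Real.sqrt 2 * (2 * Real.pi)) =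
            (3 * Real.sqrt 2 * s₀) * (s₀ * δ₁) := by field_simp
        _ ≤ lam ^ ((2 : ℝ) - 3 * (b - 1) ^ 2) * (s₀ * δ₁) := mul_le_mul_of_nonneg_right HD1 (by positivity)
        _ = lam ^ ((2 : ℝ) - 3 * (b - 1) ^ 2) * s₀ * δ₁ := by ring
  · -- (2.8) for `φ₀ = 0`
    intro k _
    exact derivSupOn_zero _ _ (by positivity)
  · -- (2.8), advective part, for `φ₀ = 0`
    intro k _
    rw [hadv0]
    exact derivSupOn_zero _ _ (by positivity)

end Start

/-! ## Part 4. The induction and Thm. 1.1 from Prop. 2.3 -/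

section Induction

/-- A stage of the iteration: a tuple `(v, p, R, κ, φ)` of fields on `ℝ × 𝕋³`. [cite: DelellisKwon2022, Def. 2.1] -/
structure Stage where
  /-- velocity -/
  v : ℝ → 𝕋³ → ℝ³
  /-- pressure -/
  p : ℝ → 𝕋³ → ℝ
  /-- Reynolds stress (by columns) -/
  R : ℝ → 𝕋³ → Fin 3 → ℝ³
  /-- unsolved flux density -/
  κ : ℝ → 𝕋³ → ℝ
  /-- unsolved flux current -/
  φ : ℝ → 𝕋³ → ℝ³

variable {M α a b T : ℝ} {E : ℝ → ℝ} {S : ℕ → Set ℝ}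

/-- **The induction** (§2.3: "we can use inductively Proposition 2.3 to produce a sequence"):
if the stage-`0` tuple is a dissipative Euler–Reynolds flow on `S₀` with the inductive
estimates, and every stage-`q` tuple with these properties on `S_q` can be corrected to a
stage-`(q+1)` tuple on `S_{q+1}` with the increment bound (2.10) and the same pressure
(the conclusion of Prop. 2.3 with §4.2), where all `S_q ⊇ [0,T]`, `T > 0`, then the resulting
sequence (dependent choice, `BDSV.exists_seq_of_step`) restricted to `[0,T]` is a
`DLK.IsIterationSequence`. [cite: DelellisKwon2022, §2.3 (proof of Thm. 1.1, induction)] -/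
theorem exists_iterationSequence_of_step (hT : 0 < T) (hS : ∀ q, Icc 0 T ⊆ S q) {Z₀ : Stage}
    (h0 : Torus.IsDissipativeEulerReynoldsOn (S 0) Z₀.v Z₀.p Z₀.R Z₀.κ Z₀.φ E ∧
      InductiveHypothesis M α a b (S 0) 0 Z₀.v Z₀.p Z₀.R Z₀.φ)
    (hstep : ∀ (q : ℕ) (Z : Stage), Torus.IsDissipativeEulerReynoldsOn (S q) Z.v Z.p Z.R Z.κ Z.φ E →
      InductiveHypothesis M α a b (S q) q Z.v Z.p Z.R Z.φ →
      ∃ Z' : Stage, Torus.IsDissipativeEulerReynoldsOn (S (q + 1)) Z'.v Z'.p Z'.R Z'.κ Z'.φ E ∧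
        InductiveHypothesis M α a b (S (q + 1)) (q + 1) Z'.v Z'.p Z'.R Z'.φ ∧
        (∀ t ∈ S (q + 1), ∀ x, ‖Z'.v t x - Z.v t x‖ ≤ M * Real.sqrt (amp α a b (q + 1))) ∧
        (∀ i, ∀ t ∈ S (q + 1), ∀ x,
          ‖Torus.partialDeriv i (fun y => Z'.v t y - Z.v t y) x‖ ≤
            M * freq a b (q + 1) * Real.sqrt (amp α a b (q + 1))) ∧
        (∀ t ∈ S (q + 1), ∀ x, Z'.p t x = Z.p t x)) :
    ∃ Z : ℕ → Stage, Z 0 = Z₀ ∧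
      IsIterationSequence M α a b T E (fun q => (Z q).v) (fun q => (Z q).p) (fun q => (Z q).R)
        (fun q => (Z q).κ) (fun q => (Z q).φ) := by
  obtain ⟨Z, hZ0, hP, hQ⟩ := BDSV.exists_seq_of_step
    (P := fun q (Z : Stage) => Torus.IsDissipativeEulerReynoldsOn (S q) Z.v Z.p Z.R Z.κ Z.φ E ∧
      InductiveHypothesis M α a b (S q) q Z.v Z.p Z.R Z.φ)
    (Q := fun q (Z Z' : Stage) =>
      (∀ t ∈ S (q + 1), ∀ x, ‖Z'.v t x - Z.v t x‖ ≤ M * Real.sqrt (amp α a b (q + 1))) ∧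
        (∀ i, ∀ t ∈ S (q + 1), ∀ x,
          ‖Torus.partialDeriv i (fun y => Z'.v t y - Z.v t y) x‖ ≤
            M * freq a b (q + 1) * Real.sqrt (amp α a b (q + 1))) ∧
        (∀ t ∈ S (q + 1), ∀ x, Z'.p t x = Z.p t x))
    h0 (fun q Z hZ => by
      obtain ⟨Z', h1, h2, h3, h4, h5⟩ := hstep q Z hZ.1 hZ.2
      exact ⟨Z', ⟨h1, h2⟩, h3, h4, h5⟩)
  refine ⟨Z, hZ0, ?_⟩
  exact {
    flow := fun q => (hP q).1.mono_Icc (hS q) hT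
    velocity_sup := fun q t ht x => (hP q).2.velocity_zero.norm_le (hS q ht) x
    velocity_deriv := fun q i t ht x => by
      have := ((hP q).2.velocity_le 1 le_rfl (by norm_num)).norm_partialDeriv_le i (hS q ht) x
      simpa using this
    pressure_deriv := fun q i t ht x => by
      have := ((hP q).2.pressure_le 1 (by norm_num)).norm_partialDeriv_le i (hS q ht) x
      simpa using this
    stress_sup := fun q t ht x => by
      have := ((hP q).2.stress_le 0 (by norm_num)).norm_le (hS q ht) x
      simpa using this
    stress_deriv := fun q i t ht x => by
      have := ((hP q).2.stress_le 1 (by norm_num)).norm_partialDeriv_le i (hS q ht) x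
      simpa using this
    current_sup := fun q t ht x => by
      have := ((hP q).2.current_le 0 (by norm_num)).norm_le (hS q ht) x
      simpa using this
    increment_sup := fun q t ht x => (hQ q).1 t (hS (q + 1) ht) x
    increment_deriv := fun q i t ht x => (hQ q).2.1 i t (hS (q + 1) ht) x
    pressure_succ := fun q t ht x => (hQ q).2.2 t (hS (q + 1) ht) x }

/-! ### Numerical constants -/

/-- `√2 ≤ 3/2`. [folklore] -/
theorem sqrt_two_le : Real.sqrt 2 ≤ 3 / 2 := by
  rw [show (3 : ℝ) / 2 = Real.sqrt ((3 / 2) ^ 2) by rw [Real.sqrt_sq (by norm_num)]]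
  exact Real.sqrt_le_sqrt (by norm_num)

/-- `√2 · 2π ≤ 10`. [folklore] -/
theorem sqrt_two_mul_two_pi_le : Real.sqrt 2 * (2 * Real.pi) ≤ 10 := by
  nlinarith [sqrt_two_le, Real.pi_lt_d2, Real.pi_pos, Real.sqrt_nonneg 2]

/-- `√2 · (2π)² ≤ 60`. [folklore] -/
theorem sqrt_two_mul_two_pi_sq_le : Real.sqrt 2 * (2 * Real.pi) ^ 2 ≤ 60 := by
  nlinarith [sqrt_two_le, Real.pi_lt_d2, Real.pi_pos, Real.sqrt_nonneg 2, sq_nonneg Real.pi]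

/-- `3√2 ≤ 2π`. [folklore] -/
theorem three_sqrt_two_le_two_pi : 3 * Real.sqrt 2 ≤ 2 * Real.pi := by
  nlinarith [sqrt_two_le, Real.pi_gt_three]

/-! ### Thm. 1.1 from Prop. 2.3 -/

/-- **De Lellis–Kwon 2022, Thm. 1.1 from the inductive proposition (Prop. 2.3).** The
hypothesis `hprop` transcribes Prop. 2.3 with its printed quantifier structure — "There exists a
geometric constant `M > 1` and functions `b̄(α) > 1` and `Λ₀(α, b, M) > 0` such that the following
property holds. Let `α ∈ (0, 1/7)`, `b ∈ (1, b̄(α))` and `λ₀ ≥ Λ₀(α, b, M)` and assume that a tuple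
`(v_q, p_q, R_q, κ_q, φ_q)` is a dissipative Euler–Reynolds flow defined on the time interval
`[0,T] + τ_{q-1}` satisfying (2.4)–(2.8) for an energy loss `E(t)` satisfying (2.9). Then, we can
find a corrected dissipative Euler–Reynolds flow `(v_{q+1}, p_{q+1}, R_{q+1}, κ_{q+1}, φ_{q+1})` on
the time interval `[0,T] + τ_q` for the same energy loss `E(t)` which satisfies (2.4)–(2.8) for
`q+1` and `‖v_{q+1} - v_q‖₀ + λ_{q+1}⁻¹‖v_{q+1} - v_q‖₁ ≤ Mδ_{q+1}^{1/2}`" — in the tree's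
vocabulary: the frequency parameter is `a` (`λ_q = 2π⌈a^{b^q}⌉ = BDSV.freq a b q`,
`δ_q = BDSV.amp α a b q`), dissipative Euler–Reynolds flows are `Torus.IsDissipativeEulerReynoldsOn`
(Def. 2.1), (2.4)–(2.8) are `DLK.InductiveHypothesis`, (2.9) is `DLK.EnergyLossHypothesis`, the
time domains `[0,T] + τ_{q-1}` are left to the step as any sets `S_q ⊇ [0,T]` with `S₀ = ℝ`
(`τ₋₁ = ∞`), (2.10) is split into its sup and first-derivative parts, and the pressure is kept,
`p_{q+1} = p_q` (§4.2). Under `hprop` — the convex-integration construction of §§3–11, NOT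
proved in the tree — the named fact `Torus.DeLellisKwon2022_thm11` holds: given `β < 1/7` and
`T > 0`, choose `α = (β + 1/7)/2`, `b ∈ (1, b̄)` with `3(b-1)² ≤ α`,
`a ≥ max{Λ₀, 100, 6^{1/α}}`, the energy loss of `DLK.exists_energyLoss`, start from the tuple of
§2.3 (`DLK.InductiveHypothesis.start`, `DLK.isDissipativeEulerReynoldsOn_start_sqrt`), iterate
(`DLK.exists_iterationSequence_of_step`) and pass to the limit
(`DLK.deLellisKwon2022_thm11_of_iterationSequences`). [cite: DelellisKwon2022, Thm. 1.1 (proof, §2.3) and Prop. 2.3] -/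
theorem deLellisKwon2022_thm11_of_inductiveProposition
    (hprop : ∃ M : ℝ, 1 < M ∧ ∀ α : ℝ, 0 < α → α < 1 / 7 → ∃ bbar : ℝ, 1 < bbar ∧
      ∀ b : ℝ, 1 < b → b < bbar → ∃ Λ₀ : ℝ, ∀ a : ℝ, Λ₀ ≤ a → ∀ T : ℝ, 0 < T →
        ∀ E : ℝ → ℝ, EnergyLossHypothesis α a b E →
          ∃ S : ℕ → Set ℝ, S 0 = univ ∧ (∀ q, Icc 0 T ⊆ S q) ∧
            ∀ (q : ℕ) (v : ℝ → 𝕋³ → ℝ³) (p : ℝ → 𝕋³ → ℝ) (R : ℝ → 𝕋³ → Fin 3 → ℝ³)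
              (κ : ℝ → 𝕋³ → ℝ) (φ : ℝ → 𝕋³ → ℝ³),
              Torus.IsDissipativeEulerReynoldsOn (S q) v p R κ φ E →
              InductiveHypothesis M α a b (S q) q v p R φ →
              ∃ (v' : ℝ → 𝕋³ → ℝ³) (p' : ℝ → 𝕋³ → ℝ) (R' : ℝ → 𝕋³ → Fin 3 → ℝ³)
                (κ' : ℝ → 𝕋³ → ℝ) (φ' : ℝ → 𝕋³ → ℝ³),
                Torus.IsDissipativeEulerReynoldsOn (S (q + 1)) v' p' R' κ' φ' E ∧
                InductiveHypothesis M α a b (S (q + 1)) (q + 1) v' p' R' φ' ∧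
                (∀ t ∈ S (q + 1), ∀ x, ‖v' t x - v t x‖ ≤ M * Real.sqrt (amp α a b (q + 1))) ∧
                (∀ i, ∀ t ∈ S (q + 1), ∀ x,
                  ‖Torus.partialDeriv i (fun y => v' t y - v t y) x‖ ≤
                    M * freq a b (q + 1) * Real.sqrt (amp α a b (q + 1))) ∧
                (∀ t ∈ S (q + 1), ∀ x, p' t x = p t x)) :
    Torus.DeLellisKwon2022_thm11 := by
  refine deLellisKwon2022_thm11_of_iterationSequences fun β hβ0 hβ7 T hT => ?_
  -- parameters
  set α : ℝ := (β + 1 / 7) / 2 with hαdef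
  have hα0 : 0 < α := by rw [hαdef]; linarith
  have hβα : β < α := by rw [hαdef]; linarith
  have hα7 : α < 1 / 7 := by rw [hαdef]; linarith
  have hα1 : α ≤ 1 := by linarith
  obtain ⟨M, hM, hM'⟩ := hprop
  obtain ⟨bbar, hbbar, hb'⟩ := hM' α hα0 hα7
  set b : ℝ := 1 + min ((bbar - 1) / 2) (α / 3) with hbdef
  have hmin0 : 0 < min ((bbar - 1) / 2) (α / 3) := lt_min (by linarith) (by linarith)
  have hb1 : 1 < b := by rw [hbdef]; linarith
  have hbb : b < bbar := by
    have := min_le_left ((bbar - 1) / 2) (α / 3)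
    rw [hbdef]; linarith
  have hγ : 3 * (b - 1) ^ 2 ≤ α := by
    have h1 : b - 1 ≤ α / 3 := by rw [hbdef]; linarith [min_le_right ((bbar - 1) / 2) (α / 3)]
    have h2 : 0 ≤ b - 1 := by linarith
    nlinarith
  have hγ0 : 0 ≤ 3 * (b - 1) ^ 2 := by positivity
  obtain ⟨Λ₀, hΛ⟩ := hb' b hb1 hbb
  set a : ℝ := max Λ₀ (max 100 ((6 : ℝ) ^ (1 / α))) with hadef
  have haΛ : Λ₀ ≤ a := le_max_left _ _
  have ha100 : (100 : ℝ) ≤ a := (le_max_left _ _).trans (le_max_right _ _)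
  have ha6 : (6 : ℝ) ^ (1 / α) ≤ a := (le_max_right _ _).trans (le_max_right _ _)
  have ha1 : (1 : ℝ) ≤ a := by linarith
  have ha1' : (1 : ℝ) < a := by linarith
  -- the frequencies and amplitudes at `q = 0, 1`
  set lam := freq a b 0 with hlam
  have hlam_a : a ≤ lam := le_freq ha1 hb1.le 0
  have hlam100 : (100 : ℝ) ≤ lam := ha100.trans hlam_a
  have hlam1 : (1 : ℝ) ≤ lam := by linarith
  have hlam0 : (0 : ℝ) < lam := by linarith
  have hδ₀pos : 0 < amp α a b 0 := amp_pos ha1 0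
  have hδ₀1 : amp α a b 0 ≤ 1 := amp_le_one ha1 hα0.le 0
  have hδ₁pos : 0 < amp α a b 1 := amp_pos ha1 1
  have hs₀ : Real.sqrt (amp α a b 0) = lam ^ (-α) := sqrt_amp ha1 α b 0
  have hδ₁δ₀ : amp α a b 1 ≤ amp α a b 0 := amp_succ_le ha1 hb1.le hα0.le 0
  have hδ₀s₀ : amp α a b 0 ≤ Real.sqrt (amp α a b 0) := amp_le_sqrt_amp ha1 hα0.le 0
  -- `s₀ = λ₀^{-α} ≤ a^{-α} ≤ 1/6`
  have hs₀6 : Real.sqrt (amp α a b 0) ≤ 1 / 6 := by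
    rw [hs₀]
    have h1 : lam ^ (-α) ≤ a ^ (-α) := Real.rpow_le_rpow_of_nonpos (by linarith) hlam_a (by linarith)
    have h2 : a ^ (-α) ≤ ((6 : ℝ) ^ (1 / α)) ^ (-α) :=
      Real.rpow_le_rpow_of_nonpos (by positivity) ha6 (by linarith)
    have h3 : ((6 : ℝ) ^ (1 / α)) ^ (-α) = 1 / 6 := by
      rw [← Real.rpow_mul (by norm_num), show (1 / α) * -α = -1 by field_simp, Real.rpow_neg_one]
      norm_num
    linarith
  have hs₀pos : 0 < Real.sqrt (amp α a b 0) := Real.sqrt_pos.2 hδ₀pos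
  -- power facts
  have hpow1 : (10 : ℝ) ≤ lam ^ (1 - α) := by
    have h1 : lam ^ ((1 : ℝ) / 2) ≤ lam ^ (1 - α) :=
      Real.rpow_le_rpow_of_exponent_le hlam1 (by linarith)
    have h2 : (100 : ℝ) ^ ((1 : ℝ) / 2) ≤ lam ^ ((1 : ℝ) / 2) :=
      Real.rpow_le_rpow (by norm_num) hlam100 (by norm_num)
    have h3 : (100 : ℝ) ^ ((1 : ℝ) / 2) = 10 := by
      rw [show (100 : ℝ) = 10 ^ (2 : ℝ) by norm_num, ← Real.rpow_mul (by norm_num)]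
      norm_num
    linarith
  have hpow2 : (100 : ℝ) ≤ lam ^ (2 - α) := by
    have h1 : lam ^ (1 : ℝ) ≤ lam ^ (2 - α) := Real.rpow_le_rpow_of_exponent_le hlam1 (by linarith)
    rw [Real.rpow_one] at h1
    linarith
  have hpow3 : (1 : ℝ) ≤ lam ^ (1 - 3 * (b - 1) ^ 2) := Real.one_le_rpow hlam1 (by linarith)
  have hpow4 : (100 : ℝ) ≤ lam ^ (2 - 3 * (b - 1) ^ 2) := by
    have h1 : lam ^ (1 : ℝ) ≤ lam ^ (2 - 3 * (b - 1) ^ 2) :=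
      Real.rpow_le_rpow_of_exponent_le hlam1 (by linarith)
    rw [Real.rpow_one] at h1
    linarith
  have hpow5 : lam ^ (-α) ≤ lam ^ (-(3 * (b - 1) ^ 2)) :=
    Real.rpow_le_rpow_of_exponent_le hlam1 (by linarith)
  have hlamsa : lam * Real.sqrt (amp α a b 0) = lam ^ (1 - α) := freq_mul_sqrt_amp ha1 0
  have hlam2sa : lam ^ 2 * Real.sqrt (amp α a b 0) = lam ^ (2 - α) := by
    rw [hs₀, sub_eq_add_neg, Real.rpow_add hlam0, Real.rpow_two]
  -- the energy loss
  obtain ⟨E, hEs, hE0, hE', hET, hEb, hE1, hE2⟩ := exists_energyLoss hδ₀pos hδ₀1 hδ₁pos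
  have hEH : EnergyLossHypothesis α a b E :=
    ⟨hEs, hE0, hE', fun t => abs_le.2 ⟨(hEb t).1, (hEb t).2.trans hδ₁pos.le⟩, hE1⟩
  -- the step
  obtain ⟨S, hS0, hS, hstep⟩ := hΛ a haΛ T hT E hEH
  -- the starting tuple and its estimates
  have hpos : ∀ t, 0 < 1 - 2 * Real.sqrt (amp α a b 0) + E t := fun t => by
    linarith only [(hEb t).1, hs₀6, hδ₁δ₀, hδ₀s₀]
  have hflow0 : Torus.IsDissipativeEulerReynoldsOn (S 0)
      (CDLDR.shearVelocity 1 fun t => Real.sqrt (1 - 2 * Real.sqrt (amp α a b 0) + E t)) (fun _ _ => 0)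
      (startStress 1 fun t => Real.sqrt (1 - 2 * Real.sqrt (amp α a b 0) + E t)) (fun _ _ => 0)
      (fun _ _ => 0) E := by
    rw [hS0]
    exact isDissipativeEulerReynoldsOn_start_sqrt (n := 1) le_rfl hEs hpos
  have hsq2 := sqrt_two_le
  have hsq0 := Real.sqrt_nonneg 2
  have HE : 2 * Real.sqrt (amp α a b 0) + amp α a b 1 ≤ 1 / 2 := by
    linarith only [hs₀6, hδ₁δ₀, hδ₀s₀]
  have HV1 : Real.sqrt 2 * (2 * Real.pi) ≤ M * freq a b 0 * Real.sqrt (amp α a b 0) := by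
    rw [mul_assoc, hlamsa]
    calc Real.sqrt 2 * (2 * Real.pi) ≤ 10 := sqrt_two_mul_two_pi_le
      _ ≤ 1 * lam ^ (1 - α) := by linarith only [hpow1]
      _ ≤ M * lam ^ (1 - α) := mul_le_mul_of_nonneg_right hM.le (by positivity)
  have HV2 : Real.sqrt 2 * (2 * Real.pi) ^ 2 ≤ M * freq a b 0 ^ 2 * Real.sqrt (amp α a b 0) := by
    rw [mul_assoc, hlam2sa]
    calc Real.sqrt 2 * (2 * Real.pi) ^ 2 ≤ 60 := sqrt_two_mul_two_pi_sq_le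
      _ ≤ 1 * lam ^ (2 - α) := by linarith only [hpow2]
      _ ≤ M * lam ^ (2 - α) := mul_le_mul_of_nonneg_right hM.le (by positivity)
  have HR0 : Real.sqrt 2 * Real.sqrt (amp α a b 0) ≤ 2 * Real.pi * freq a b 0 ^ (-(3 * (b - 1) ^ 2)) := by
    rw [hs₀]
    calc Real.sqrt 2 * lam ^ (-α) ≤ 2 * Real.pi * lam ^ (-α) :=
          mul_le_mul_of_nonneg_right (by linarith only [three_sqrt_two_le_two_pi, hsq0])
            (Real.rpow_nonneg hlam0.le _)
      _ ≤ 2 * Real.pi * lam ^ (-(3 * (b - 1) ^ 2)) := mul_le_mul_of_nonneg_left hpow5 (by positivity)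
  have HR1 : Real.sqrt 2 * Real.sqrt (amp α a b 0) ≤ freq a b 0 ^ (1 - 3 * (b - 1) ^ 2) :=
    calc Real.sqrt 2 * Real.sqrt (amp α a b 0) ≤ 3 / 2 * (1 / 6) :=
          mul_le_mul hsq2 hs₀6 hs₀pos.le (by norm_num)
      _ ≤ 1 := by norm_num
      _ ≤ lam ^ (1 - 3 * (b - 1) ^ 2) := hpow3
  have HR2 : Real.sqrt 2 * (2 * Real.pi) * Real.sqrt (amp α a b 0) ≤ freq a b 0 ^ (2 - 3 * (b - 1) ^ 2) :=
    calc Real.sqrt 2 * (2 * Real.pi) * Real.sqrt (amp α a b 0) ≤ 10 * (1 / 6) :=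
          mul_le_mul sqrt_two_mul_two_pi_le hs₀6 hs₀pos.le (by norm_num)
      _ ≤ 100 := by norm_num
      _ ≤ lam ^ (2 - 3 * (b - 1) ^ 2) := hpow4
  have HD0 : 3 * Real.sqrt 2 * Real.sqrt (amp α a b 0) ≤ 2 * Real.pi * freq a b 0 ^ (1 - 3 * (b - 1) ^ 2) :=
    calc 3 * Real.sqrt 2 * Real.sqrt (amp α a b 0) ≤ 3 * Real.sqrt 2 * 1 :=
          mul_le_mul_of_nonneg_left (by linarith only [hs₀6]) (by positivity)
      _ ≤ 2 * Real.pi * 1 := by linarith only [three_sqrt_two_le_two_pi]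
      _ ≤ 2 * Real.pi * lam ^ (1 - 3 * (b - 1) ^ 2) := mul_le_mul_of_nonneg_left hpow3 (by positivity)
  have HD1 : 3 * Real.sqrt 2 * Real.sqrt (amp α a b 0) ≤ freq a b 0 ^ (2 - 3 * (b - 1) ^ 2) :=
    calc 3 * Real.sqrt 2 * Real.sqrt (amp α a b 0) ≤ 3 * (3 / 2) * (1 / 6) := by
          have : 3 * Real.sqrt 2 ≤ 3 * (3 / 2) := by linarith only [hsq2]
          exact mul_le_mul this hs₀6 hs₀pos.le (by norm_num)
      _ ≤ 100 := by norm_num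
      _ ≤ lam ^ (2 - 3 * (b - 1) ^ 2) := hpow4
  have hIH0 : InductiveHypothesis M α a b (S 0) 0
      (CDLDR.shearVelocity 1 fun t => Real.sqrt (1 - 2 * Real.sqrt (amp α a b 0) + E t)) (fun _ _ => 0)
      (startStress 1 fun t => Real.sqrt (1 - 2 * Real.sqrt (amp α a b 0) + E t)) (fun _ _ => 0) := by
    rw [hS0]
    exact InductiveHypothesis.start ha1 hb1.le hα0.le hEs hEb hE1 hE2 HE HV1 HV2 HR0 HR1 HR2 HD0 HD1
  -- iterate
  obtain ⟨Z, -, hseq⟩ := exists_iterationSequence_of_step (M := M) (α := α) (a := a) (b := b) hT hS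
    (Z₀ := ⟨CDLDR.shearVelocity 1 fun t => Real.sqrt (1 - 2 * Real.sqrt (amp α a b 0) + E t), fun _ _ => 0,
      startStress 1 fun t => Real.sqrt (1 - 2 * Real.sqrt (amp α a b 0) + E t), fun _ _ => 0, fun _ _ => 0⟩)
    ⟨hflow0, hIH0⟩
    (fun q Z hflow hIH => by
      obtain ⟨v', p', R', κ', φ', h1, h2, h3, h4, h5⟩ := hstep q Z.v Z.p Z.R Z.κ Z.φ hflow hIH
      exact ⟨⟨v', p', R', κ', φ'⟩, h1, h2, h3, h4, h5⟩)
  exact ⟨M, α, a, b, E, _, _, _, _, _, hβα, hα1, ha1', hb1, by linarith, hseq,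
    fun t _ => hE' t, hET T hT⟩

end Induction

end DLK

end Literature.Analysis.FluidPDE
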